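import Literature.Computability.Complexity.CountingHierarchyProofs
import Literature.Computability.Complexity.PolyAdviceClosure
import Literature.Computability.Complexity.CoinCounting
import Literature.Computability.Complexity.StringSwap
import HarnessLib

/-!
# `PP ⊆ P/poly ⇒ CH ⊆ P/poly` from `P/poly ⊆ P/poly-advice` (proofs; trunk CplxCore)

Sibling proof file of `CountingHierarchy.lean` (D-0014). Bürgisser's Lemma 2.5(2) (ECCC TR06-113),
the named fact `CH_subset_PPoly_of_PP_subset_PPoly`, is PROVED here from (one inclusion of) the
textbook fact `PPoly_eq_polyAdvice_P` (`P/poly = P` with polynomial advice, Arora–Barak 2009,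
Thm. 6.18, i.e. CIRCUIT-EVALUATION `∈ P`), which the tree keeps as a named fact in
`CircuitClasses.lean`:

* `assocFn` — re-association `⟨⟨a, b⟩, c⟩ ↦ ⟨a, ⟨b, c⟩⟩` in `FP` (from `copyFn`, `mapFstFn`,
  `mapSndFn` and the projections; no new machine);
* `uniformProb_congr` — events that agree on the strings of length `m` have the same `uniformProb m`;
* `pMajority_PPoly_subset_PPoly` — **if `PP ⊆ P/poly` and `P/poly ⊆ P/poly-advice` then
  `C'·(P/poly) ⊆ P/poly`**: for `L ∈ C'·(P/poly)` with witness `L' ∈ P/poly`, write `L'` as a `P`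
  language `L''` with advice `a`; the majority vote over `L''` with the advice moved into the input,
  `M = {⟨x, b⟩ | Pr_y[⟨⟨x, y↾p|x|⟩, b⟩ ∈ L''] > 1/2}`, is in `PP ⊆ P/poly`, and
  `x ∈ L ↔ ⟨x, a(2|x| + 2 + p|x|)⟩ ∈ M` puts `L ∈ (P/poly)/poly = P/poly` (`polyAdvice_PPoly_subset_PPoly`)
  — Bürgisser's induction step (proof of Lemma 2.5) with Arora–Barak's advice characterisation;
* `CkP_subset_PPoly_of`, `CH_subset_PPoly_of_PP_subset_PPoly_of` (from `PPoly ⊆ polyAdvice P`) and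
  `CH_subset_PPoly_of_PP_subset_PPoly_of_eq` (from `PPoly_eq_polyAdvice_P`).

## References

* P. Bürgisser, *On defining integers and proving arithmetic circuit lower bounds*, Comput.
  Complexity 18 (2009) = ECCC TR06-113, Lemma 2.5 and its proof.
* S. Arora, B. Barak, *Computational Complexity: A Modern Approach*, CUP 2009, Def. 6.16,
  Thm. 6.18, §17.2.1.
-/

namespace Literature.Computability.Complexity

open _root_.Computability

/-! ### Re-association of nested pairs -/

/-- Re-association `⟨⟨a, b⟩, c⟩ ↦ ⟨a, ⟨b, c⟩⟩`: copy, replace the first copy by its first-first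
component and the second copy by `mapFst snd`. [folklore] -/
noncomputable def assocFn : List Bool → List Bool :=
  mapSndFn (mapFstFn fun z => (boolUnpair z).2) ∘
    mapFstFn ((fun z => (boolUnpair z).1) ∘ fun z => (boolUnpair z).1) ∘ copyFn

/-- `assocFn ∈ FP`. [cite: AroraBarak2009, Thm. 2.8] -/
theorem assocFn_mem_FP : assocFn ∈ FP :=
  comp_mem_FP (mapSndFn_mem_FP (mapFstFn_mem_FP boolUnpairSnd_mem_FP))
    (comp_mem_FP (mapFstFn_mem_FP (comp_mem_FP boolUnpairFst_mem_FP boolUnpairFst_mem_FP))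
      copyFn_mem_FP)

/-- **`assocFn ⟨⟨a, b⟩, c⟩ = ⟨a, ⟨b, c⟩⟩`.** [folklore] -/
@[simp] theorem assocFn_boolPair (a b c : List Bool) :
    assocFn (boolPair (boolPair a b) c) = boolPair a (boolPair b c) := by
  simp [assocFn, Function.comp_apply, copyFn_apply, mapFstFn_boolPair, mapSndFn_boolPair]

/-! ### Events agreeing on the strings of the right length -/

/-- Events that agree on the strings of length `m` have the same `uniformProb m`. [folklore] -/
theorem uniformProb_congr {m : ℕ} {E E' : Set (List Bool)}
    (h : ∀ y : List Bool, y.length = m → (y ∈ E ↔ y ∈ E')) : uniformProb m E = uniformProb m E' := by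
  rw [uniformProb_eq_cnt_div, uniformProb_eq_cnt_div, cnt_congr h]

/-! ### The induction step of Bürgisser's Lemma 2.5(2) -/

/-- The map `⟨⟨x, b⟩, y'⟩ ↦ ⟨⟨x, y'↾p(|x|)⟩, b⟩` (truncate the coins, move the advice out), in `FP`. [folklore] -/
theorem adviceCoinFn_mem_FP (p : Polynomial ℕ) :
    (swapFn ∘ mapSndFn (truncSndFn p) ∘ assocFn ∘ mapFstFn swapFn) ∈ FP :=
  comp_mem_FP swapFn_mem_FP (comp_mem_FP (mapSndFn_mem_FP (truncSndFn_mem_FP p))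
    (comp_mem_FP assocFn_mem_FP (mapFstFn_mem_FP swapFn_mem_FP)))

/-- Its value on `⟨⟨x, b⟩, y'⟩`. [folklore] -/
theorem adviceCoinFn_apply (p : Polynomial ℕ) (x b y' : List Bool) :
    (swapFn ∘ mapSndFn (truncSndFn p) ∘ assocFn ∘ mapFstFn swapFn) (boolPair (boolPair x b) y') =
      boolPair (boolPair x (y'.take (p.eval x.length))) b := by
  simp [Function.comp_apply, mapFstFn_boolPair, swapFn_boolPair, assocFn_boolPair, mapSndFn_boolPair,
    truncSndFn_boolPair]

/-- **The induction step of Lemma 2.5(2)**: if `PP ⊆ P/poly` and `P/poly ⊆ P/poly-advice`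
(Arora–Barak 2009, Thm. 6.18), then `C'·(P/poly) ⊆ P/poly` (Bürgisser, ECCC TR06-113, proof of
Lemma 2.5: the majority vote over the advice-taking `P` predicate is a `PP` language queried with
the advice, and `(P/poly)/poly = P/poly`). [cite: Burgisser2006, Lemma 2.5] -/
theorem pMajority_PPoly_subset_PPoly (hPP : PP ⊆ PPoly) (h618 : PPoly ⊆ polyAdvice Classes.P) :
    pMajority PPoly ⊆ PPoly := by
  intro L hL
  obtain ⟨L', hL', p, hp⟩ := hL
  obtain ⟨L'', hL''P, a, q, hq, ha⟩ := h618 hL'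
  -- the `P` predicate with truncated coins and the advice moved out, and its majority vote
  set g := swapFn ∘ mapSndFn (truncSndFn p) ∘ assocFn ∘ mapFstFn swapFn with hg
  set E : Language Bool := g ⁻¹' L'' with hE
  have hEP : E ∈ Classes.P := preimage_mem_P hL''P (adviceCoinFn_mem_FP p)
  set M : Language Bool := {w | 1 / 2 < uniformProb (p.eval w.length) {y' : List Bool | boolPair w y' ∈ E}}
    with hM
  have hMPP : M ∈ PP := ⟨E, hEP, p, fun w => Iff.rfl⟩
  -- membership of `⟨x, b⟩` in `M`
  have hmemM : ∀ x b : List Bool, boolPair x b ∈ M ↔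
      1 / 2 < uniformProb (p.eval x.length) {y : List Bool | boolPair (boolPair x y) b ∈ L''} := by
    intro x b
    change 1 / 2 < uniformProb (p.eval (boolPair x b).length) {y' : List Bool | boolPair (boolPair x b) y' ∈ E} ↔ _
    have hset : {y' : List Bool | boolPair (boolPair x b) y' ∈ E} =
        {y' | y'.take (p.eval x.length) ∈ {y : List Bool | boolPair (boolPair x y) b ∈ L''}} := by
      ext y'
      change g (boolPair (boolPair x b) y') ∈ L'' ↔ _
      rw [hg, adviceCoinFn_apply]
      rfl
    have hle : p.eval x.length ≤ p.eval (boolPair x b).length :=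
      TM2Iter.eval_mono p (by rw [length_boolPair]; omega)
    rw [hset, uniformProb_take_of_le hle]
  -- `L` with the advice `a (2n + 2 + p n)` queries `M`
  have hLadv : L ∈ polyAdvice PP := by
    refine ⟨M, hMPP, fun n => a (2 * n + 2 + p.eval n), q.comp (2 * Polynomial.X + 2 + p), fun n => ?_,
      fun x => ?_⟩
    · simpa using hq (2 * n + 2 + p.eval n)
    · rw [hp x, hmemM]
      rw [uniformProb_congr (E' := {y : List Bool | boolPair (boolPair x y) (a (2 * x.length + 2 + p.eval x.length)) ∈ L''})
        fun y hy => ?_]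
      change boolPair x y ∈ L' ↔ _
      rw [ha (boolPair x y), length_boolPair, hy]
      rfl
  exact polyAdvice_subset_PPoly hPP hLadv

/-- **Every level of `CH` is in `P/poly`** if `PP ⊆ P/poly` and `P/poly ⊆ P/poly-advice`
(induction on the level). [cite: Burgisser2006, Lemma 2.5] -/
theorem CkP_subset_PPoly_of (hPP : PP ⊆ PPoly) (h618 : PPoly ⊆ polyAdvice Classes.P) (k : ℕ) : CkP k ⊆ PPoly := by
  induction k with
  | zero => exact (P_subset_CkP 1).trans hPP
  | succ k ih =>
    intro L hL
    obtain ⟨L', hL', p, hp⟩ := hL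
    exact pMajority_PPoly_subset_PPoly hPP h618 ⟨L', ih hL', p, hp⟩

/-- **Bürgisser's Lemma 2.5(2) from Arora–Barak's Thm. 6.18 (`P/poly ⊆ P/poly-advice`)**:
`PP ⊆ P/poly ⇒ CH ⊆ P/poly`. [cite: Burgisser2006, Lemma 2.5] -/
theorem CH_subset_PPoly_of_PP_subset_PPoly_of (h618 : PPoly ⊆ polyAdvice Classes.P) :
    CH_subset_PPoly_of_PP_subset_PPoly := by
  intro hPP L hL
  obtain ⟨k, hk⟩ := mem_CH_iff.1 hL
  exact CkP_subset_PPoly_of hPP h618 k hk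

/-- The same from the named fact `PPoly_eq_polyAdvice_P` (Arora–Barak 2009, Thm. 6.18). [cite: AroraBarak2009, Thm. 6.18] -/
theorem CH_subset_PPoly_of_PP_subset_PPoly_of_eq (h : PPoly_eq_polyAdvice_P) :
    CH_subset_PPoly_of_PP_subset_PPoly :=
  CH_subset_PPoly_of_PP_subset_PPoly_of h.le

end Literature.Computability.Complexity
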